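import Mathlib
import Summits.Ventures.PercRepro2.LocRows
import Summits.Ventures.PercRepro2.SwRow
import Summits.Ventures.PercRepro2.SwOut
import Summits.Ventures.PercRepro2.SwAllRow
import Summits.Ventures.PercRepro2.SwOutAll
import Summits.Ventures.PercRepro2.SwOutArmFlip
import Summits.Ventures.PercRepro2.SwOutArmThm
import Summits.Ventures.PercRepro2.SwOutCoreDefs
import Summits.Ventures.PercRepro2.SwOutBigBlockDefs
import Summits.Ventures.PercRepro2.SwOutMixedBaseDefs
import Summits.Ventures.PercRepro2.SwOutMixedBaseClasses
import Summits.Ventures.PercRepro2.SwOutMixedBaseHull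
import Summits.Ventures.PercRepro2.SwOutMixedBaseDual
import Summits.Ventures.PercRepro2.SwOutMixedCore
import Summits.Ventures.PercRepro2.SwOutMixedCoreEdgeMap
import Summits.Ventures.PercRepro2.SwOutMixedCoreMoveUP

/-!
# The generic move principle for the conditioning (blind cell PercRepro2, night-4 g18,
2026-08-27; proofs/NIGHT4-G18.md §5, item (G3) of NIGHT4-G17.md §4⁗′ — the general case)

**Principle** (`mem_tgtU_of_turned_blue`, pure graph theory): passing from a colouring `ζ` to `ζ'`,
the conditioning `tgtU = {h ∉ H_l, o ∈ C_R(l), o ∉ C_B(l)}` is kept as soon as `l` is outside the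
hull of `h` at `ζ'` and EVERY EDGE TURNED FROM RED TO BLUE has an end in the red cluster of `h` at
`ζ` and an end in the blue cluster of `h` at `ζ'` (edges turned red are free).  Red side: the set
`C_R(l)(ζ') ∪ C_R(h)(ζ)` is closed under the red edges of `ζ`, so `C_R(l)(ζ) ⊆` it, and `o` is not in
`C_R(h)(ζ)`.  Blue side: along a blue path of `ζ'` from `l` no turned edge can be used, since it
would put `l` into `C_B(h)(ζ')` — a closedness argument relative to the cluster
(`mem_of_conn_of_closed_in`) — so `C_B(l)(ζ') ⊆ C_B(l)(ζ)`.

Applied to the mixed single junction (`mem_tgtU_of_le`): for cube points `q' ≤ q`, both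
non-leaking, the edges turned blue lie in the classes whose coordinate dropped — a u-arm, the
h-piece, a far arm (red at `q`, hence in `C_R(h)(q)`; blue at `q'`, hence in `C_B(h)(q')`, by the
hull formulas), or the u–p edges (then `u` must be in `C_R(h)(q)`: some u-arm red at `q`, and in
`C_B(h)(q')`: some u-arm blue at `q'`); the outside edges of `p` only turn red.  Together with
the two u–p moves at unmixed u-arms (`SwOutMixedCoreMoveUP`) this is the whole block-lowerness
(G3) of the conditioning — see `SwOutMixedCoreBlockLower`.
-/

namespace Summit.Ventures.PercRepro2

namespace BigBlock

open Hull LocRows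

variable {V : Type*} {E : Type*}

section Generic

variable {ends : E → Sym2 V}

/-- **Closure lemma, relative to the cluster**: a set containing `v` and closed under open
adjacency from its points that are connected to `v` contains everything connected to `v`. -/
lemma mem_of_conn_of_closed_in {ω : Config E} {S : Set V} {v : V}
    (hS : ∀ x ∈ S, Conn ends ω v x → ∀ y, (openGraph ends ω).Adj x y → y ∈ S) {u : V}
    (hv : v ∈ S) (h : Conn ends ω v u) : u ∈ S := by
  rw [Conn, SimpleGraph.reachable_iff_reflTransGen] at h
  induction h with
  | refl => exact hv
  | tail hvx hxy ih =>
    exact hS _ ih (by rw [Conn, SimpleGraph.reachable_iff_reflTransGen]; exact hvx) _ hxy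

/-- **The generic move principle**: if `l` is outside the hull of `h` after the move and every
edge turned from red to blue has an end in the red cluster of `h` before and an end in the blue
cluster of `h` after, the conditioning is kept. -/
theorem mem_tgtU_of_turned_blue [Fintype E] [DecidableEq E] {ζ ζ' : Config E} {l h o : V}
    (hlh : l ∉ hull ends ζ' h)
    (hred : ∀ e, ζ e = true → ζ' e = false → ∃ x y, ends e = s(x, y) ∧ x ∈ cluster ends ζ h)
    (hblue : ∀ e, ζ e = true → ζ' e = false →
      ∃ x y, ends e = s(x, y) ∧ x ∈ cluster ends (blue ζ') h)
    (hQ : ζ ∈ tgtU ends l h {S : Set V | o ∈ S}) : ζ' ∈ tgtU ends l h {S : Set V | o ∈ S} := by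
  simp only [hull, Set.mem_union, not_or] at hlh
  rw [mem_tgtU_iff'] at hQ ⊢
  obtain ⟨⟨hhA, _⟩, hoA, hoB⟩ := hQ
  refine ⟨⟨fun hh => hlh.1 (conn_symm hh), fun hh => hlh.2 (conn_symm hh)⟩, ?_, ?_⟩
  · -- the red side
    have key : o ∈ cluster ends ζ' l ∪ cluster ends ζ h := by
      refine mem_of_conn_of_closed (S := cluster ends ζ' l ∪ cluster ends ζ h) ?_
        (Or.inl (mem_cluster_self _ _ _)) hoA
      rintro a (ha | ha) b hab
      · obtain ⟨_, e, he, hends⟩ := openGraph_adj.1 hab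
        by_cases he' : ζ' e = true
        · exact Or.inl (mem_cluster_of_edge ha he' hends)
        · obtain ⟨x, y, hxy, hx⟩ := hred e he (by simpa using he')
          -- both ends of the red edge `e` are in `C_R(h)(ζ)`
          have hy : y ∈ cluster ends ζ h := mem_cluster_of_edge hx he hxy
          rw [hxy, Sym2.eq_iff] at hends
          rcases hends with ⟨_, rfl⟩ | ⟨rfl, _⟩
          · exact Or.inr hy
          · exact Or.inr hx
      · exact Or.inr (mem_cluster_of_adj ha hab)
    rcases key with key | key
    · exact key
    · exact absurd (SimpleGraph.Reachable.trans hoA (conn_symm key)) hhA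
  · -- the blue side
    intro ho'
    refine hoB (mem_of_conn_of_closed_in (S := cluster ends (blue ζ) l) ?_
      (mem_cluster_self _ _ _) ho')
    intro a ha hla b hab
    obtain ⟨_, e, he, hends⟩ := openGraph_adj.1 hab
    simp only [blue, Bool.not_eq_true'] at he
    by_cases he0 : ζ e = false
    · exact mem_cluster_of_edge ha (by simp [blue, he0]) hends
    · obtain ⟨x, y, hxy, hx⟩ := hblue e (by simpa using he0) he
      -- the blue edge `e` of `ζ'` lies in `C_B(h)(ζ')`, so does `a`, so does `l`
      have hy : y ∈ cluster ends (blue ζ') h := mem_cluster_of_edge hx (by simp [blue, he]) hxy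
      have ha' : a ∈ cluster ends (blue ζ') h := by
        rw [hxy, Sym2.eq_iff] at hends
        rcases hends with ⟨rfl, _⟩ | ⟨_, rfl⟩
        · exact hx
        · exact hy
      exact absurd (SimpleGraph.Reachable.trans ha' (conn_symm hla)) hlh.2

end Generic

section Mixed

variable {ι κ : Type*} {ends : E → Sym2 V} {σ : Config E} {h u p : V} {U : ι → Set V} {Ah : Set V}
  {F : κ → Set V} (hb : MixedBase ends σ h u p U Ah F)
include hb

/-- The colour of an edge in no class is the base colour (all points). -/
lemma MixedBase.turned_blue_class {q q' : Pt ι κ} (hle : q' ≤ q) {e : E}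
    (h1 : mixedReal ends u p U Ah F σ q e = true)
    (h2 : mixedReal ends u p U Ah F σ q' e = false) :
    (∃ j, q.1 j = true ∧ q'.1 j = false ∧ e ∈ touches ends (U j)) ∨
      (q.2.1 = true ∧ q'.2.1 = false ∧ e ∈ touches ends Ah) ∨
      (q.2.2.1 = true ∧ q'.2.2.1 = false ∧ e ∈ clsUP ends u p) ∨
      (∃ k, q.2.2.2.2 k = true ∧ q'.2.2.2.2 k = false ∧ e ∈ touches ends (F k)) := by
  obtain ⟨hs, ha, huP, he, hf⟩ := hle
  by_cases hU : ∃ j, e ∈ touches ends (U j)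
  · obtain ⟨j, hj⟩ := hU
    left
    refine ⟨j, ?_⟩
    rw [hb.mixedReal_apply_U hj] at h1 h2
    have hsj := Bool.le_iff_imp.1 (hs j)
    cases hq : q.1 j <;> cases hq' : q'.1 j <;> rw [hq] at h1 <;> rw [hq'] at h2 <;>
      simp_all
  by_cases hA : e ∈ touches ends Ah
  · right; left
    rw [hb.mixedReal_apply_Ah hA] at h1 h2
    have ha' := Bool.le_iff_imp.1 ha
    cases hq : q.2.1 <;> cases hq' : q'.2.1 <;> rw [hq] at h1 <;> rw [hq'] at h2 <;> simp_all
  by_cases hUP : e ∈ clsUP ends u p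
  · right; right; left
    rw [hb.mixedReal_apply_UP hUP] at h1 h2
    have huP' := Bool.le_iff_imp.1 huP
    cases hq : q.2.2.1 <;> cases hq' : q'.2.2.1 <;> rw [hq] at h1 <;> rw [hq'] at h2 <;> simp_all
  by_cases hF : ∃ k, e ∈ touches ends (F k)
  · obtain ⟨k, hk⟩ := hF
    right; right; right
    refine ⟨k, ?_⟩
    rw [hb.mixedReal_apply_F hk] at h1 h2
    have hfk := Bool.le_iff_imp.1 (hf k)
    cases hq : q.2.2.2.2 k <;> cases hq' : q'.2.2.2.2 k <;> rw [hq] at h1 <;> rw [hq'] at h2 <;>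
      simp_all
  by_cases hX : e ∈ clsExt ends u p Ah
  · exfalso
    rw [hb.mixedReal_apply_Ext hX] at h1 h2
    obtain ⟨x, hpx, hxu, hxA⟩ := hX
    have hσ := hb.ext_blue e x hpx hxu hxA
    have he' := Bool.le_iff_imp.1 he
    cases hq : q.2.2.2.1 <;> cases hq' : q'.2.2.2.1 <;> rw [hq] at h1 <;> rw [hq'] at h2 <;>
      simp_all
  · exfalso
    rw [MixedBase.mixedReal_apply_none (fun j hj => hU ⟨j, hj⟩) hA hUP hX (fun k hk => hF ⟨k, hk⟩)]
      at h1 h2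
    rw [h1] at h2
    exact absurd h2 (by decide)

/-- **The generic move of the mixed single junction**: for cube points `q' ≤ q`, both
non-leaking, the conditioning is kept — provided the u–p edges do not turn blue, or some u-arm is
red at `q` and some u-arm blue at `q'`. -/
theorem MixedBase.mem_tgtU_of_le [Fintype E] [DecidableEq E] (hup : ∃ e, ends e = s(u, p))
    {Us : Set V} {l o : V} (hUs : {h} ∪ {u} ∪ {p} ∪ armsAll U Ah F ⊆ Us) (hl : l ∉ Us)
    {q q' : Pt ι κ} (hle : q' ≤ q) (hqR : ¬ LeakR q) (hqB' : ¬ LeakB q')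
    (hR' : ¬ LeakR q') (hB' : ¬ LeakB q')
    (huP : q'.2.2.1 = q.2.2.1 ∨ ((∃ j, q.1 j = true) ∧ ∃ j, q'.1 j = false))
    (hQ : mixedReal ends u p U Ah F σ q ∈ tgtU ends l h {S : Set V | o ∈ S}) :
    mixedReal ends u p U Ah F σ q' ∈ tgtU ends l h {S : Set V | o ∈ S} := by
  refine mem_tgtU_of_turned_blue
    (fun hl' => hl (hUs (hb.hull_mixedReal_subset hup hR' hB' hl'))) ?_ ?_ hQ
  · -- an end in the red cluster of `h` at `q`
    intro e h1 h2
    rw [hb.cluster_mixedReal hup hqR]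
    rcases hb.turned_blue_class hle h1 h2 with ⟨j, hj, _, x, hx, y, hxy⟩ | ⟨ha, _, x, hx, y, hxy⟩ |
      ⟨hP, hP', hUP⟩ | ⟨k, hk, _, x, hx, y, hxy⟩
    · exact ⟨x, y, hxy, (hb.mem_redSetM_U hx).2 hj⟩
    · exact ⟨x, y, hxy, (hb.mem_redSetM_Ah hx).2 ha⟩
    · refine ⟨u, p, hUP, hb.mem_redSetM_u.2 ?_⟩
      rcases huP with huP | ⟨hs, _⟩
      · rw [huP, hP] at hP'
        exact absurd hP' (by decide)
      · exact hs
    · exact ⟨x, y, hxy, (hb.mem_redSetM_F hx).2 hk⟩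
  · -- an end in the blue cluster of `h` at `q'`
    intro e h1 h2
    rw [hb.cluster_blue_mixedReal hup hqB']
    rcases hb.turned_blue_class hle h1 h2 with ⟨j, _, hj', x, hx, y, hxy⟩ | ⟨_, ha', x, hx, y, hxy⟩ |
      ⟨hP, hP', hUP⟩ | ⟨k, _, hk', x, hx, y, hxy⟩
    · refine ⟨x, y, hxy, (hb.mem_redSetM_U hx).2 ?_⟩
      simp [flipPt, flipAll, hj']
    · refine ⟨x, y, hxy, (hb.mem_redSetM_Ah hx).2 ?_⟩
      simp [flipPt, ha']
    · refine ⟨u, p, hUP, hb.mem_redSetM_u.2 ?_⟩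
      rcases huP with huP | ⟨_, j, hj⟩
      · rw [huP, hP] at hP'
        exact absurd hP' (by decide)
      · exact ⟨j, by simp [flipPt, flipAll, hj]⟩
    · refine ⟨x, y, hxy, (hb.mem_redSetM_F hx).2 ?_⟩
      simp [flipPt, flipAll, hk']

end Mixed

end BigBlock

end Summit.Ventures.PercRepro2
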